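import Literature.Barriers.PneNP.MatchingSlackPsdApproximation
import Literature.Combinatorics.Optimization.PsdRankBasicProperties
import Literature.Combinatorics.Optimization.PsdRankComparisons
import HarnessLib

/-!
# Barrier: support-based arguments cannot certify psd rank above `C(n,2) + 1` for the matching slack matrix
# (Fawzi–Gouveia–Parrilo–Robinson–Thomas 2015, §5.2 with Theorem 2.9 (v); Lee–Theis 2012)

H. Fawzi, J. Gouveia, P. A. Parrilo, R. Z. Robinson, R. R. Thomas, *Positive semidefinite rank*,
Math. Program. Ser. B 153 (2015) 133–177 = arXiv:1407.4095 [FawziEtAl2015] (held text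
`paper:arxiv-1407.4095`, arXiv page numbering), **§5.2 "Lower bounds for psd rank"** (p15), verbatim:

"Lower bounds based solely on the support of the matrix have been shown to be quite powerful in the
case of nonnegative rank (see [FKPT13] for an overview). In the case of psd rank, their power is much
more limited. Given a matrix `M`, the entry-wise square `M ∘ M` has the same support as `M` and has
psd rank bounded above by `rank(M)` (Theorem 2.9, part (v)). Thus, a purely support-based bound
cannot produce a lower bound that is higher than the rank of `M`. This observation was extended by
Lee and Theis in [LT12] as follows: Theorem 5.8. Fix a support `Z` and let `𝓜_Z` be the set of all
matrices sharing this support. Then `min_{A ∈ 𝓜_Z} rank(A) = min_{A ∈ 𝓜_Z, A ≥ 0} rank_psd(A)`."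
and (p15–p16): "To obtain stronger lower bounds, we need to move past using only the support of a
matrix. The only known lower bounding techniques that are not purely support based rely on the
quantifier elimination theory of Renegar … as seen in [GPT13]."

Both ingredients are THEOREMS of the tree: Theorem 2.9 (v) is
`Literature.Combinatorics.Optimization.HasPsdFactorization.hadamardSq` /
`hasPsdFactorization_hadamardSq_rank` (`PsdRankBasicProperties.lean`) and Theorem 5.8 is
`exists_nonneg_sameSupport_hasPsdFactorization_rank` + `FawziEtAl2015_thm58_holds`
(`PsdRankComparisons.lean`). This file SPECIALISES the printed observation to the object of the
FGPRT open problem — the odd-cut slack matrix `S_{UM} = |δ(U) ∩ M| − 1` of the perfect matching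
polytope of `K_n` (`pmOddCutSlack`, rows `OddSet n`, columns `PMatch n`, the Rothvoß files'
vocabulary) — and PROVES it (no named fact):

* `IsSupportBasedPsdBound n R` — the TECHNIQUE CLASS as a Lean definition: `R` is certified by a
  support-based argument iff EVERY entrywise nonnegative matrix on `OddSet n × PMatch n` with the same
  zero pattern as `S` has psd rank `≥ R` (no psd factorisation of size `< R`). Fooling-set / psd
  fooling-set bounds (`HasPsdFactorization.card_le_of_triangular` in the tree), rectangle-cover and
  min-rank-of-the-support bounds certify exactly such `R`.
* `hasPsdFactorization_pmOddCutSlack_sq` — the Hadamard square `S ∘ S` (same support as `S`) has an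
  explicit psd factorisation of size `C(n,2) + 1`, because `S_{UM} = Σ_{e ∈ E(K_n)} 1[e ∈ δ(U)]·1[e ∈ M]
  − 1·1` is an ordinary factorisation through `ℝ^{E(K_n) ⊕ 1}` (Theorem 2.9 (v), factorisation form).
* `supportBasedPsdBound_le` — the BARRIER: every support-based psd-rank lower bound for the matching
  slack matrix of `K_n` satisfies `R ≤ C(n,2) + 1`.

technique_class: support-based (zero-pattern) psd-rank lower bounds — arguments whose conclusion
  `rk_psd(S) ≥ R` uses only the support of `S` and hence holds for every nonnegative matrix with that
  support (`IsSupportBasedPsdBound`): psd fooling sets / triangular-submatrix bounds, support-rank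
  (Lee–Theis) bounds, rectangle-covering-style arguments. [cite: FawziEtAl2015, §5.2 (p15)]
blocks: any super-polynomial — in particular any `2^{Ω(n^δ)}` — lower bound on the psd rank of the
  odd-cut slack matrix of the perfect matching polytope of `K_n` (the FGPRT open problem; Dagstuhl
  15082 OP 7) obtained by a support-based argument: such arguments certify at most `C(n,2) + 1`. It
  does NOT block value-sensitive methods. [cite: FawziEtAl2015, §5.2 (p15), Thm. 2.9 (v) (p06–p07)]
because: `S ∘ S` has the same support as `S` and `rk_psd(S ∘ S) ≤ rank(S)` (Thm. 2.9 (v): a rank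
  factorisation `S_{ij} = ⟨a_i, b_j⟩` gives the psd factorisation `A_i = a_ia_iᵀ`, `B_j = b_jb_jᵀ`);
  here `rank(S) ≤ |E(K_n)| + 1 = C(n,2) + 1` by the explicit factorisation through edge indicators.
  [cite: FawziEtAl2015, Thm. 2.9 (v) (p06–p07); §5.2 (p15)]
evasions_known: value-sensitive techniques — Renegar quantifier elimination / algebraic degree of
  sets with small psd lifts (Gouveia–Parrilo–Thomas; FGPRT Prop. 5.12, Cor. 5.13) [cite: FawziEtAl2015, §5.2 (p15–p16)];
  sum-of-squares degree of pattern matrices via pseudo-densities and quantum learning (Lee–Raghavendra–Steurer,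
  for TSP/CUT/STAB slack matrices — in the tree as `LeeRaghavendraSteurer2015_thm38` and its corollaries)
  [cite: LeeRaghavendraSteurer2015, Thm. 3.8]; symmetry-restricted formulations (Braun et al., symmetric
  SDPs for matching, proved in the tree as `BraunEtAl2016_symmetricSDP_matching_holds`) [cite: BraunEtAl2016, Thm. 4.10].
  None of these is known to apply to the (unrestricted) matching slack matrix.
scope_caveats: the printed observation is about ALL matrices and all support-based bounds; the
  specialisation and the explicit constant `C(n,2) + 1` (an upper bound for `rank S`; the exact rank
  of the odd-cut block is not computed here) are ours and are proved below. The barrier says nothing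
  about arguments that use the VALUES `|δ(U) ∩ M| − 1` (e.g. the hyperplane-separation / tracial-design
  route of cell pnp-psdrank, or the approximation-robust class bounded separately by
  `KaniewskiLeeDewolf2015_thm19.ceiling`), and nothing about `rk_psd(S)` itself, which remains open.
  [cite: FawziEtAl2015, §5.2 (p15)]
status: established (Math. Program. 2015; Theorem 2.9 (v) and Theorem 5.8 are proved in the tree).
-/

noncomputable section

open Finset

namespace Literature.Barriers.PneNP

open Literature.Combinatorics.Optimization (HasPsdFactorization
  exists_nonneg_sameSupport_hasPsdFactorization_rank)
open Literature.Combinatorics.SimpleGraph.CycleSpace (Crosses crosses_mk)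

variable {n : ℕ}

/-! ### The technique class -/

/-- **Support-based psd-rank lower bound** (the technique class of FGPRT §5.2): `R` is certified for
the odd-cut slack matrix `S` of `K_n` by a support-based argument iff every entrywise nonnegative
matrix `N` on `OddSet n × PMatch n` with the same zero pattern as `S` (`N_{UM} = 0 ↔ S_{UM} = 0`)
admits no psd factorisation of size `< R`. [cite: FawziEtAl2015, §5.2 (p15)] -/
def IsSupportBasedPsdBound (n : ℕ) (R : ℕ) : Prop :=
  ∀ N : OddSet n → PMatch n → ℝ, (∀ U M, 0 ≤ N U M) →
    (∀ U M, N U M = 0 ↔ pmOddCutSlack n U M = 0) → ∀ r : ℕ, r < R → ¬HasPsdFactorization N r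

/-- The class is monotone: a support-based certificate for `R` is one for every `R' ≤ R`.
[cite: FawziEtAl2015, §5.2 (p15)] -/
theorem IsSupportBasedPsdBound.mono {R R' : ℕ} (h : IsSupportBasedPsdBound n R) (hR : R' ≤ R) :
    IsSupportBasedPsdBound n R' :=
  fun N hN hsupp r hr => h N hN hsupp r (lt_of_lt_of_le hr hR)

/-! ### The slack matrix factors through the edges of `K_n` -/

/-- The non-loop edges of `K_n`, `E(K_n)`, as a type (`|E(K_n)| = C(n,2)`). [folklore] -/
abbrev Edge (n : ℕ) : Type := {e : Sym2 (Fin n) // ¬e.IsDiag}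

/-- `|E(K_n)| = C(n,2)`. [folklore] -/
private theorem card_edge (n : ℕ) : Fintype.card (Edge n) = n.choose 2 := by
  rw [Sym2.card_subtype_not_diag, Fintype.card_fin]

/-- A loop `s(x,x)` crosses no vertex set. [folklore] -/
private theorem not_crosses_of_isDiag (A : Finset (Fin n)) {e : Sym2 (Fin n)} (he : e.IsDiag) :
    ¬Crosses A e := by
  induction e using Sym2.ind with
  | h x y =>
    rw [Sym2.mk_isDiag_iff] at he
    subst he
    rw [crosses_mk]
    tauto

/-- Row factor of the slack matrix through `E(K_n) ⊕ 1`: `a_U(e) = 1[e ∈ δ(U)]`, `a_U(⋆) = −1`.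
[cite: FawziEtAl2015, Thm. 2.9 (v) proof (p07, "a factorization of `M` … `a_i, b_j ∈ ℝ^r`")] -/
def rowFactor (U : OddSet n) : Edge n ⊕ Unit → ℝ
  | Sum.inl e => if Crosses U.1 e.1 then 1 else 0
  | Sum.inr _ => -1

/-- Column factor: `b_M(e) = 1[e ∈ M]`, `b_M(⋆) = 1`. [cite: FawziEtAl2015, Thm. 2.9 (v) proof (p07)] -/
def colFactor (M : PMatch n) : Edge n ⊕ Unit → ℝ
  | Sum.inl e => if e.1 ∈ M.1 then 1 else 0
  | Sum.inr _ => 1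

/-- `|δ(U) ∩ M| = Σ_{e ∈ E(K_n)} 1[e ∈ δ(U)]·1[e ∈ M]` (loops never cross, so the non-loop edges
suffice). [cite: Rothvoss2017, §2 (PDF p. 5)] -/
theorem cc_eq_sum_edge (U : OddSet n) (M : PMatch n) :
    (cc U M : ℝ) = ∑ e : Edge n,
      (if Crosses U.1 e.1 then (1 : ℝ) else 0) * (if e.1 ∈ M.1 then (1 : ℝ) else 0) := by
  classical
  unfold cc
  calc (((M.1.filter (Crosses U.1)).card : ℕ) : ℝ)
      = ∑ e ∈ M.1, (if Crosses U.1 e then (1 : ℝ) else 0) := by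
        rw [Finset.card_filter, Nat.cast_sum]
        simp only [Nat.cast_ite, Nat.cast_one, Nat.cast_zero]
    _ = ∑ e ∈ M.1, (if ¬e.IsDiag then
          (if Crosses U.1 e then (1 : ℝ) else 0) * (if e ∈ M.1 then (1 : ℝ) else 0) else 0) := by
        refine sum_congr rfl fun e he => ?_
        by_cases hd : e.IsDiag
        · rw [if_neg (not_crosses_of_isDiag U.1 hd), if_neg (not_not.mpr hd)]
        · rw [if_pos hd, if_pos he, mul_one]
    _ = ∑ e ∈ (univ : Finset (Sym2 (Fin n))), (if ¬e.IsDiag then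
          (if Crosses U.1 e then (1 : ℝ) else 0) * (if e ∈ M.1 then (1 : ℝ) else 0) else 0) := by
        refine Finset.sum_subset (subset_univ _) fun e _ he => ?_
        simp [he]
    _ = ∑ e ∈ (univ : Finset (Sym2 (Fin n))).filter (fun e => ¬e.IsDiag),
          (if Crosses U.1 e then (1 : ℝ) else 0) * (if e ∈ M.1 then (1 : ℝ) else 0) := by
        rw [Finset.sum_filter]
    _ = ∑ e : Edge n,
          (if Crosses U.1 e.1 then (1 : ℝ) else 0) * (if e.1 ∈ M.1 then (1 : ℝ) else 0) := by
        rw [Finset.sum_subtype ((univ : Finset (Sym2 (Fin n))).filter (fun e => ¬e.IsDiag))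
          (p := fun e : Sym2 (Fin n) => ¬e.IsDiag) (fun e => by simp)]

/-- **The slack matrix is an ordinary factorisation through `ℝ^{E(K_n) ⊕ 1}`**:
`|δ(U) ∩ M| − 1 = Σ_x a_U(x) b_M(x)`. [cite: FawziEtAl2015, Thm. 2.9 (v) proof (p07)] -/
theorem pmOddCutSlack_eq_sum_factor (U : OddSet n) (M : PMatch n) :
    pmOddCutSlack n U M = ∑ x : Edge n ⊕ Unit, rowFactor U x * colFactor M x := by
  rw [pmOddCutSlack_apply, Fintype.sum_sum_type, cc_eq_sum_edge]
  simp [rowFactor, colFactor, sub_eq_add_neg]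

/-! ### Theorem 2.9 (v) applied: the Hadamard square of the slack matrix -/

/-- **`S ∘ S` has a psd factorisation of size `|E(K_n)| + 1 = C(n,2) + 1`** (Theorem 2.9 (v) on the
explicit factorisation above: `A_U = a_Ua_Uᵀ`, `B_M = b_Mb_Mᵀ`, `⟨A_U, B_M⟩ = ⟨a_U, b_M⟩² = S_{UM}²`),
and `S ∘ S` has the same support as `S`. [cite: FawziEtAl2015, Thm. 2.9 (v) (p06–p07); §5.2 (p15)] -/
theorem hasPsdFactorization_pmOddCutSlack_sq (n : ℕ) :
    HasPsdFactorization (fun (U : OddSet n) (M : PMatch n) => pmOddCutSlack n U M ^ 2)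
      (n.choose 2 + 1) := by
  classical
  let eqv : (Edge n ⊕ Unit) ≃ Fin (Fintype.card (Edge n ⊕ Unit)) := Fintype.equivFin _
  have hcard : Fintype.card (Edge n ⊕ Unit) = n.choose 2 + 1 := by
    rw [Fintype.card_sum, card_edge, Fintype.card_unit]
  have h : HasPsdFactorization (fun (U : OddSet n) (M : PMatch n) => pmOddCutSlack n U M ^ 2)
      (Fintype.card (Edge n ⊕ Unit)) := by
    refine HasPsdFactorization.hadamardSq (fun U l => rowFactor U (eqv.symm l))
      (fun M l => colFactor M (eqv.symm l)) fun U M => ?_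
    rw [pmOddCutSlack_eq_sum_factor]
    exact (Equiv.sum_comp eqv.symm (fun x => rowFactor U x * colFactor M x)).symm
  rwa [hcard] at h

/-! ### The barrier -/

/-- **FGPRT §5.2, verbatim content, for any matrix**: "a purely support-based bound cannot produce a
lower bound that is higher than the rank of `M`" — if every nonnegative matrix with the support of
`S` has psd rank `≥ R`, then `R ≤ rank S` (Lee–Theis direction of Theorem 5.8, proved in the tree as
`exists_nonneg_sameSupport_hasPsdFactorization_rank`). [cite: FawziEtAl2015, §5.2 (p15), Thm. 5.8] -/
theorem supportBased_le_rank {ι κ : Type} [Fintype ι] [Fintype κ] (S : Matrix ι κ ℝ) {R : ℕ}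
    (h : ∀ N : Matrix ι κ ℝ, (∀ i j, 0 ≤ N i j) → (∀ i j, N i j = 0 ↔ S i j = 0) →
      ∀ r : ℕ, r < R → ¬HasPsdFactorization N r) :
    R ≤ S.rank := by
  obtain ⟨N, hN, hsupp, hfac⟩ := exists_nonneg_sameSupport_hasPsdFactorization_rank S
  by_contra hlt
  exact h N hN hsupp S.rank (lt_of_not_ge hlt) hfac

/-- **BARRIER (FGPRT §5.2 specialised to Edmonds' slack matrix).** Every support-based psd-rank lower
bound `R` for the odd-cut slack matrix `S_{UM} = |δ(U) ∩ M| − 1` of the perfect matching polytope of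
`K_n` satisfies `R ≤ C(n,2) + 1`: the Hadamard square `S ∘ S` is a nonnegative matrix with the same
support and a psd factorisation of that size. In particular no zero-pattern argument (psd fooling
sets, support min-rank, rectangle covers) can give a super-polynomial bound for the FGPRT open
problem. [cite: FawziEtAl2015, §5.2 (p15); Thm. 2.9 (v) (p06–p07)] -/
theorem supportBasedPsdBound_le {R : ℕ} (h : IsSupportBasedPsdBound n R) : R ≤ n.choose 2 + 1 := by
  by_contra hlt
  refine h (fun U M => pmOddCutSlack n U M ^ 2) (fun U M => sq_nonneg _) (fun U M => ?_)
    (n.choose 2 + 1) (lt_of_not_ge hlt) (hasPsdFactorization_pmOddCutSlack_sq n)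
  exact sq_eq_zero_iff

end Literature.Barriers.PneNP
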